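import Summits.QuantumFields.YangMills.Theorems.BalabanUVNodesN15KingModelFullPropagatorOperator

/-!
# BalabanUVNodes ∕ N15 — THE KING-MODEL RUNG, CURVED EDITION (PART P′): THE OPERATOR-FORM η-RATE OF THE FULL `A = 0` FLUCTUATION
# PROPAGATOR WITH KING'S PRINTED DECAY FROM THE SUPPORT — `|Σ_{y′} η′^{d+1}[G^{η′}_{K+n}(x′, y′) − G^η_K(x, y)]f′(y′)| ≤
# C·(L^{−γ∕2})^K·e^{−δ·dist(B(x), supp f′)}·‖f′‖_∞`, all sources, uniformly in the number of levels
# (Track A, DAG node N15 = NE2; FAN-OUT v1.1 §N15 s3 «KING-MODEL RUNG … + the one-line statement of what the curved case adds»)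

HONEST FRAMING.  Count-neutral kernel bookkeeping (cell `pub-ymgap`, seat `pub-ymgap-dag-n15-e` g6; `--supports stmt-QuantumFields-19912
--as helper` = K3‴ `SpineGivenEndpointR13`, lineage K3 19676 → K3′ 19908).  TEMPLATE LITERATURE, `A = 0`: C. King's scalar U(1)-Higgs MODEL
on finite tori ([King1986] (2.13)–(2.17) p. 653, (2.20) p. 654, Theorem 3.3 (3.7) p. 658 («|(G_k(A) f)(x)| ≤ C exp[−δ₀ dist(x, supp f)]‖f‖»),
Prop. 3.8 (3.71) p. 664, (4.42)–(4.43) p. 675; [Ba 4] (1.10), (2.39)), NOT Bałaban's covariant objects; the statement is the (2.17)-summed SHAPE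
of (3.7) + (3.71), not a printed proposition; NE2⁺ is NOT PRINTED for those and not proved here; NOT a node discharge; nothing continuum ∕ ℝ⁴ ∕
OS ∕ mass-gap ∕ Clay.  0 `sorry`, 0 `def`, standard axioms.

THE POINT.  Part P (`…FullPropagatorOperator`, `fullPropOp_rate_unif`) proved the sup-norm η-rate of the full propagator as an operator on
η′-weighted sources, for ALL sources.  THIS FILE adds the printed decay factor from the support: the same induction on `K` (part P's operator
peel `fullPropOp_peel_pair`), now carrying the weight `e^{−δD}` for sources vanishing on the fine points whose unit block is within torus
distance `< D` of the block of the observation point — block distances only GROW under the peel (`D_sub ≥ L·D − (L − 1) ≥ D` for integer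
`D ≥ 1`, part O-a `mul_tdistT_blockOf_le`), so the weight passes to the induction hypothesis unchanged, and the slice pair pays `e^{−(κ∕2)D}` out of
its decay (`sliceOp_pair_decay_le`).  Base `K = 1`: [Ba 4] (1.10) WITH decay in King's spelling (`King1986.Torus.fineOp_inv_mulVec_decay_unif`,
`PropagatorDecayUniform` §5) for the fine run; the one-level kernel bound `constrainedProp_decay_blocks_unif` with the half-rate row sum for the
coarse run read through the pairing.
* `sliceOp_pair_decay_le`; ★ **`fullPropOp_rate_decay_unif`** (`D : ℕ`; `δ = min(δ₀, δ_b∕2, κ∕2)`).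
HONEST SCOPE.  As part P; (ii′) the distance is the unit-torus distance of BLOCKS (King's `dist(x, supp f)` ≥ it minus 2, immaterial for the shape).
Locators: [King1986] C. King, CMP **102** (1986) 649–677: (2.17) p. 653, (2.20) p. 654, Theorem 3.3 (3.7) p. 658, Prop. 3.8 (3.71) p. 664, (4.42)–(4.43)
p. 675; [Ba 4] = [Balaban1983RegularityDecay] Theorem (1.10) p. 573, (2.39) p. 582.
-/

noncomputable section

namespace Summit.QuantumFields.YangMills.BalabanUVNodes.N15KingModelRung.Curved

open Real Finset Matrix
open Literature.MathematicalPhysics.QuantumFieldTheory.Balaban1983to89 (Params)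
open Literature.MathematicalPhysics.QuantumFieldTheory.Balaban1983to89.B4Sect5Proof (latticeConst latticeConst_nonneg)
open Literature.MathematicalPhysics.QuantumFieldTheory.Balaban1983to89.B5Prop11Plancherel (Tor fine)
open Literature.MathematicalPhysics.QuantumFieldTheory.King1986 (aK aK_pos)
open Literature.MathematicalPhysics.QuantumFieldTheory.King1986.Torus (constrainedProp fineOp flatten blockOf tdistT torCongr
  blockOf_flatten tdistT_nonneg tdistT_sumBound constrainedProp_decay_blocks_unif fineOp_inv_mulVec_decay_unif)

variable {d : ℕ} (L : ℕ) [NeZero L]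

/-! ## §1 The slice pair against a source supported away from the observation block -/

/-- **The slice pair against a source supported `≥ D` blocks away, in the fine measure**: with the `(C_r, κ)` of part M `ksSlice_rate_unif`,
`|f| ≤ F` and `f(y′) = 0` whenever `|B(x) − B(y)|_U < D`:
`|Σ_{y′}(L^nL^K)^{−(d+1)}[ksSlice′(x′, y′) − ksSlice(u x′, u y′)]f(y′)| ≤ C_r·K(κ∕2)·(L^{−γ∕2})^K·e^{−(κ∕2)D}·F`.
[cite: King1986, (4.42)–(4.43) p.675; Balaban1983RegularityDecay, (2.39) p.582] -/
theorem sliceOp_pair_decay_le {a m2 Cr κ γ : ℝ} (hκ : 0 < κ) (hCr : 0 ≤ Cr) (i : KSliceIdx d)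
    (Hr : ∀ x' y' : Tor (fine (L ^ i.n * L ^ i.j) (ksU L i)),
      |ksSlice' L a m2 i x' y' - ksSlice L a m2 i (underPtN L i.j i.n (ksU L i) x') (underPtN L i.j i.n (ksU L i) y')|
        ≤ Cr * (((L : ℝ) ^ (-(γ / 2))) ^ i.j)
          * Real.exp (-(κ * tdistT (ksU L i) (blockOf (L ^ i.j) (ksU L i) (underPtN L i.j i.n (ksU L i) x'))
              (blockOf (L ^ i.j) (ksU L i) (underPtN L i.j i.n (ksU L i) y')))))
    (f : Tor (fine (L ^ i.n * L ^ i.j) (ksU L i)) → ℝ) {F D : ℝ} (hF : ∀ y', |f y'| ≤ F)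
    (x' : Tor (fine (L ^ i.n * L ^ i.j) (ksU L i)))
    (hsupp : ∀ y', f y' ≠ 0 → D ≤ tdistT (ksU L i) (blockOf (L ^ i.j) (ksU L i) (underPtN L i.j i.n (ksU L i) x'))
      (blockOf (L ^ i.j) (ksU L i) (underPtN L i.j i.n (ksU L i) y'))) :
    |∑ y', (((L ^ i.n * L ^ i.j : ℕ) : ℝ) ^ (d + 1))⁻¹ *
        (ksSlice' L a m2 i x' y' - ksSlice L a m2 i (underPtN L i.j i.n (ksU L i) x') (underPtN L i.j i.n (ksU L i) y')) * f y'|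
      ≤ Cr * latticeConst (d + 1) (κ / 2) * (((L : ℝ) ^ (-(γ / 2))) ^ i.j) * Real.exp (-(κ / 2 * D)) * F := by
  have hF0 : 0 ≤ F := (abs_nonneg _).trans (hF x')
  set w : ℝ := ((((L ^ i.n * L ^ i.j : ℕ) : ℝ)) ^ (d + 1))⁻¹ with hw
  have hw0 : 0 ≤ w := by positivity
  set s : ℝ := ((L : ℝ) ^ (-(γ / 2))) ^ i.j with hs
  have hs0 : 0 ≤ s := pow_nonneg (Real.rpow_nonneg (Nat.cast_nonneg _) _) _
  set b₀ := blockOf (L ^ i.n * L ^ i.j) (ksU L i) x' with hb₀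
  set E : ℝ := Real.exp (-(κ / 2 * D)) with hE
  -- termwise bound: on the support the slice decay pays `e^{−(κ∕2)D}` and keeps `e^{−(κ∕2)|B x − B y|}`; off the support the term is `0`
  have hterm : ∀ y', |w * (ksSlice' L a m2 i x' y'
        - ksSlice L a m2 i (underPtN L i.j i.n (ksU L i) x') (underPtN L i.j i.n (ksU L i) y')) * f y'|
      ≤ w * (Cr * s * E * F) * Real.exp (-(κ / 2 * tdistT (ksU L i) b₀ (blockOf (L ^ i.n * L ^ i.j) (ksU L i) y'))) := by
    intro y'
    by_cases hfy : f y' = 0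
    · rw [hfy, mul_zero, abs_zero]; positivity
    have hD := hsupp y' hfy
    have h1 := Hr x' y'
    rw [blockOf_underPtN, blockOf_underPtN] at h1 hD
    set t : ℝ := tdistT (ksU L i) b₀ (blockOf (L ^ i.n * L ^ i.j) (ksU L i) y') with ht
    have hsplit : Real.exp (-(κ * t)) ≤ E * Real.exp (-(κ / 2 * t)) := by
      rw [hE, ← Real.exp_add]
      have hκD : κ / 2 * D ≤ κ / 2 * t := mul_le_mul_of_nonneg_left hD (half_pos hκ).le
      exact Real.exp_le_exp.mpr (by linarith)
    rw [abs_mul, abs_mul, abs_of_nonneg hw0]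
    calc w * |ksSlice' L a m2 i x' y' - ksSlice L a m2 i (underPtN L i.j i.n (ksU L i) x') (underPtN L i.j i.n (ksU L i) y')| * |f y'|
        ≤ w * (Cr * s * Real.exp (-(κ * t))) * F :=
          mul_le_mul (mul_le_mul_of_nonneg_left h1 hw0) (hF y') (abs_nonneg _) (by positivity)
      _ ≤ w * (Cr * s * (E * Real.exp (-(κ / 2 * t)))) * F :=
          mul_le_mul_of_nonneg_right (mul_le_mul_of_nonneg_left (mul_le_mul_of_nonneg_left hsplit (by positivity)) hw0) hF0
      _ = w * (Cr * s * E * F) * Real.exp (-(κ / 2 * t)) := by ring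
  have hrow := rowSum_exp_blocks_le (L ^ i.n * L ^ i.j) (ksU L i) (half_pos hκ) b₀
  calc |∑ y', w * (ksSlice' L a m2 i x' y'
          - ksSlice L a m2 i (underPtN L i.j i.n (ksU L i) x') (underPtN L i.j i.n (ksU L i) y')) * f y'|
      ≤ ∑ y', |w * (ksSlice' L a m2 i x' y'
          - ksSlice L a m2 i (underPtN L i.j i.n (ksU L i) x') (underPtN L i.j i.n (ksU L i) y')) * f y'| :=
        Finset.abs_sum_le_sum_abs _ _
    _ ≤ ∑ y', w * (Cr * s * E * F) * Real.exp (-(κ / 2 * tdistT (ksU L i) b₀ (blockOf (L ^ i.n * L ^ i.j) (ksU L i) y'))) :=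
        Finset.sum_le_sum fun y' _ => hterm y'
    _ = w * (Cr * s * E * F) * ∑ y', Real.exp (-(κ / 2 * tdistT (ksU L i) b₀ (blockOf (L ^ i.n * L ^ i.j) (ksU L i) y'))) := by
        rw [Finset.mul_sum]
    _ ≤ w * (Cr * s * E * F) * ((((L ^ i.n * L ^ i.j : ℕ) : ℝ)) ^ (d + 1) * latticeConst (d + 1) (κ / 2)) :=
        mul_le_mul_of_nonneg_left (by exact_mod_cast hrow) (by positivity)
    _ = Cr * latticeConst (d + 1) (κ / 2) * s * E * F := by
        have hN : ((((L ^ i.n * L ^ i.j : ℕ) : ℝ)) ^ (d + 1)) ≠ 0 :=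
          pow_ne_zero _ (by exact_mod_cast NeZero.ne (L ^ i.n * L ^ i.j))
        rw [hw]; field_simp

/-! ## §2 The operator-form η-rate with decay from the support -/

/-- **THE TWO-SPACING η-RATE OF KING'S FULL `A = 0` FLUCTUATION PROPAGATOR AS AN OPERATOR, WITH THE PRINTED DECAY FROM THE SUPPORT**
((3.7) ∕ (1.10) currency with the (3.71) rate): for odd `L ≥ 3`, `a > 0`, a mass cap `m₀² ≥ 0` and `0 ≤ γ ≤ 1` there are `C, δ > 0` (functions of
`d, L, a, m₀², γ`) such that for EVERY `K ≥ 1`, `n ≥ 1`, cube `M_μ = 2L^e`, mass `0 < m² ≤ m₀²`, source `f′` with `|f′| ≤ F` on the fine `(K+n)`-level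
lattice, every `D ∈ ℕ` and fine point `x′` such that `f′(y′) = 0` whenever the unit blocks of `x = u x′` and `y = u y′` are at torus distance `< D`:
`|Σ_{y′}(L^nL^K)^{−(d+1)}·[G^{η′}_{K+n}(x′, y′) − G^η_K(x, y)]·f′(y′)| ≤ C·(L^{−γ∕2})^K·e^{−δD}·F`.  Induction on `K` as in part P, the weight
`e^{−δD}` riding along (module docstring). [cite: King1986, (2.13)–(2.17) p.653, (2.20) p.654, Theorem 3.3 (3.7) p.658, Prop. 3.8 (3.71) p.664, (4.42)–(4.43) p.675; Balaban1983RegularityDecay, Theorem (1.10) p.573, (2.39) p.582] -/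
theorem fullPropOp_rate_decay_unif (hLodd : Odd L) (hL : 2 ≤ L) {a : ℝ} (ha : 0 < a) {m0sq : ℝ} (hm0 : 0 ≤ m0sq) {γ : ℝ}
    (hγ0 : 0 ≤ γ) (hγ1 : γ ≤ 1) :
    ∃ C δ : ℝ, 0 < C ∧ 0 < δ ∧ ∀ (K : ℕ), 1 ≤ K → ∀ (n : ℕ), 1 ≤ n →
      ∀ (e : ℕ) (M : Fin (d + 1) → ℕ) [∀ μ, NeZero (M μ)], (∀ μ, M μ = 2 * L ^ e) →
      ∀ (msq : ℝ), 0 < msq → msq ≤ m0sq →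
      ∀ (f' : Tor (fine (L ^ n * L ^ K) M) → ℝ) (F : ℝ), (∀ y', |f' y'| ≤ F) → ∀ (D : ℕ) (x' : Tor (fine (L ^ n * L ^ K) M)),
        (∀ y', f' y' ≠ 0 → (D : ℝ) ≤ tdistT M (blockOf (L ^ K) M (underPtN L K n M x')) (blockOf (L ^ K) M (underPtN L K n M y'))) →
        |∑ y', ((((L ^ n * L ^ K : ℕ) : ℝ) ^ (d + 1))⁻¹ *
            (constrainedProp (L ^ n * L ^ K) M (aK a L (K + n)) (((L ^ n * L ^ K : ℕ) : ℝ) ^ 2) msq x' y'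
              - constrainedProp (L ^ K) M (aK a L K) (((L ^ K : ℕ) : ℝ) ^ 2) msq
                (underPtN L K n M x') (underPtN L K n M y'))
            * f' y')|
          ≤ C * (((L : ℝ) ^ (-(γ / 2))) ^ K) * Real.exp (-(δ * D)) * F := by
  have hL1 : 1 < L := by omega
  have hL1' : (1 : ℝ) ≤ L := by exact_mod_cast hL1.le
  have hL0 : (0 : ℝ) < L := by positivity
  have hLne : (L : ℝ) ≠ 0 := hL0.ne'
  have hLm1 : (1 : ℝ) ≤ (L : ℝ) - 1 := by
    have : (2 : ℝ) ≤ L := by exact_mod_cast hL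
    linarith
  set θ : ℝ := (L : ℝ) ^ (-(γ / 2)) with hθdef
  have hθ0 : 0 < θ := Real.rpow_pos_of_pos hL0 _
  have hθL : (L : ℝ)⁻¹ ≤ θ := by
    rw [hθdef, ← Real.rpow_neg_one]
    exact Real.rpow_le_rpow_of_exponent_le hL1' (by linarith)
  obtain ⟨δ₀, c₀, hδ₀, hc₀, H₀⟩ := fineOp_inv_mulVec_decay_unif (d + 1) L (by omega) ⟨hLodd, hL1⟩ ha hm0
  obtain ⟨δb, cb, hδb, hcb, Hb⟩ := constrainedProp_decay_blocks_unif (d + 1) L (by omega) ⟨hLodd, hL1⟩ ha hm0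
  obtain ⟨Cr, κ, hCr, hκ, Hr⟩ := ksSlice_rate_unif (d := d) L hLodd hL ha hm0 hγ0 hγ1
  have hKb := latticeConst_nonneg (d + 1) (half_pos hδb).le
  have hKr := latticeConst_nonneg (d + 1) (half_pos hκ).le
  -- the decay rate: below the three input rates
  set δ : ℝ := min δ₀ (min (δb / 2) (κ / 2)) with hδdef
  have hδ : 0 < δ := lt_min hδ₀ (lt_min (half_pos hδb) (half_pos hκ))
  have hδ0' : δ ≤ δ₀ := min_le_left _ _
  have hδb' : δ ≤ δb / 2 := (min_le_right _ _).trans (min_le_left _ _)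
  have hδκ : δ ≤ κ / 2 := (min_le_right _ _).trans (min_le_right _ _)
  set B₁ : ℝ := c₀ + (L : ℝ) ^ (d + 1) * cb * latticeConst (d + 1) (δb / 2) with hB₁
  have hB₁0 : 0 < B₁ := by positivity
  set C : ℝ := max ((L : ℝ) * B₁) (Cr * latticeConst (d + 1) (κ / 2) + 1) with hCdef
  have hC : 0 < C := lt_max_of_lt_left (mul_pos hL0 hB₁0)
  have hCB : (L : ℝ) * B₁ ≤ C := le_max_left _ _
  have hCr' : Cr * latticeConst (d + 1) (κ / 2) ≤ C := by
    linarith [le_max_right ((L : ℝ) * B₁) (Cr * latticeConst (d + 1) (κ / 2) + 1)]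
  -- monotonicity of the weight in the rate
  have hEmono : ∀ {r : ℝ} {D : ℕ}, δ ≤ r → Real.exp (-(r * D)) ≤ Real.exp (-(δ * D)) := fun hr =>
    Real.exp_le_exp.mpr (neg_le_neg (mul_le_mul_of_nonneg_right hr (Nat.cast_nonneg _)))
  refine ⟨C, δ, hC, hδ, ?_⟩
  intro K hK
  induction K, hK using Nat.le_induction with
  | base =>
    intro n hn e M _ hM msq hmsq hcap f' F hF D x' hsupp
    have hF0 : 0 ≤ F := (abs_nonneg _).trans (hF x')
    set w : ℝ := ((((L ^ n * L ^ 1 : ℕ) : ℝ)) ^ (d + 1))⁻¹ with hw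
    have hw0 : 0 ≤ w := by positivity
    set E : ℝ := Real.exp (-(δ * D)) with hEdef
    have hE0 : 0 < E := Real.exp_pos _
    set P' : Params := ⟨d + 1, L, e, 1 + n, by omega, ⟨hLodd, hL1⟩⟩ with hP'
    have hMK' : ∀ μ, M μ = P'.sitesPerDir P'.K := fun μ => by rw [hM μ]; simp [hP', Params.sitesPerDir]
    set P : Params := ⟨d + 1, L, e, 1, by omega, ⟨hLodd, hL1⟩⟩ with hP
    have hMK : ∀ μ, M μ = P.sitesPerDir P.K := fun μ => by rw [hM μ]; simp [hP, Params.sitesPerDir]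
    -- the support condition in the fine run's blocks
    have hsupp' : ∀ y', f' y' ≠ 0 → (D : ℝ) ≤ tdistT M (blockOf (L ^ n * L ^ 1) M x') (blockOf (L ^ n * L ^ 1) M y') := by
      intro y' hy
      have h := hsupp y' hy
      rwa [blockOf_underPtN, blockOf_underPtN] at h
    -- split the pair termwise
    have hsplit : ∀ y', w * (constrainedProp (L ^ n * L ^ 1) M (aK a L (1 + n)) (((L ^ n * L ^ 1 : ℕ) : ℝ) ^ 2) msq x' y'
          - constrainedProp (L ^ 1) M (aK a L 1) (((L ^ 1 : ℕ) : ℝ) ^ 2) msq (underPtN L 1 n M x') (underPtN L 1 n M y')) * f' y'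
        = (fineOp (L ^ n * L ^ 1) M (aK a L (1 + n)) (((L ^ n * L ^ 1 : ℕ) : ℝ) ^ 2) msq)⁻¹ x' y' * f' y'
          - w * constrainedProp (L ^ 1) M (aK a L 1) (((L ^ 1 : ℕ) : ℝ) ^ 2) msq (underPtN L 1 n M x') (underPtN L 1 n M y')
            * f' y' := by
      intro y'
      have hN0 : ((((L ^ n * L ^ 1 : ℕ) : ℝ)) ^ (d + 1)) ≠ 0 :=
        pow_ne_zero _ (by exact_mod_cast NeZero.ne (L ^ n * L ^ 1))
      have hG : constrainedProp (L ^ n * L ^ 1) M (aK a L (1 + n)) (((L ^ n * L ^ 1 : ℕ) : ℝ) ^ 2) msq x' y'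
          = (((L ^ n * L ^ 1 : ℕ) : ℝ)) ^ (d + 1)
            * (fineOp (L ^ n * L ^ 1) M (aK a L (1 + n)) (((L ^ n * L ^ 1 : ℕ) : ℝ) ^ 2) msq)⁻¹ x' y' := by
        rw [constrainedProp, Matrix.smul_apply, smul_eq_mul]
      rw [hG, hw]
      field_simp
    have hsum_eq : ∑ y', w * (constrainedProp (L ^ n * L ^ 1) M (aK a L (1 + n)) (((L ^ n * L ^ 1 : ℕ) : ℝ) ^ 2) msq x' y'
          - constrainedProp (L ^ 1) M (aK a L 1) (((L ^ 1 : ℕ) : ℝ) ^ 2) msq (underPtN L 1 n M x') (underPtN L 1 n M y')) * f' y'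
        = ∑ y', (fineOp (L ^ n * L ^ 1) M (aK a L (1 + n)) (((L ^ n * L ^ 1 : ℕ) : ℝ) ^ 2) msq)⁻¹ x' y' * f' y'
          - ∑ y', w * constrainedProp (L ^ 1) M (aK a L 1) (((L ^ 1 : ℕ) : ℝ) ^ 2) msq (underPtN L 1 n M x')
              (underPtN L 1 n M y') * f' y' := by
      rw [← Finset.sum_sub_distrib]
      exact Finset.sum_congr rfl fun y' _ => hsplit y'
    -- the fine run: (1.10) with decay from the support
    have hfine : |∑ y', (fineOp (L ^ n * L ^ 1) M (aK a L (1 + n)) (((L ^ n * L ^ 1 : ℕ) : ℝ) ^ 2) msq)⁻¹ x' y' * f' y'|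
        ≤ c₀ * E * F := by
      have h := H₀ P' rfl rfl (by show 1 ≤ 1 + n; omega) msq hmsq.le hcap M hMK' (L ^ n * L ^ 1)
        (by show L ^ n * L ^ 1 = L ^ (1 + n); rw [pow_add, mul_comm]) f' F D hF x' hsupp'
      exact h.trans (mul_le_mul_of_nonneg_right (mul_le_mul_of_nonneg_left (hEmono hδ0') hc₀.le) hF0)
    -- the coarse run read through the pairing: one-level kernel decay, half the rate for the weight, half for the row sum
    have hcoarse : |∑ y', w * constrainedProp (L ^ 1) M (aK a L 1) (((L ^ 1 : ℕ) : ℝ) ^ 2) msq (underPtN L 1 n M x')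
          (underPtN L 1 n M y') * f' y'| ≤ (L : ℝ) ^ (d + 1) * cb * latticeConst (d + 1) (δb / 2) * E * F := by
      have hb : ∀ y', |w * constrainedProp (L ^ 1) M (aK a L 1) (((L ^ 1 : ℕ) : ℝ) ^ 2) msq (underPtN L 1 n M x')
            (underPtN L 1 n M y') * f' y'|
          ≤ w * ((L : ℝ) ^ (d + 1) * cb * E * F)
            * Real.exp (-(δb / 2 * tdistT M (blockOf (L ^ n * L ^ 1) M x') (blockOf (L ^ n * L ^ 1) M y'))) := by
        intro y'
        by_cases hfy : f' y' = 0
        · rw [hfy, mul_zero, abs_zero]; positivity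
        have hDy := hsupp' y' hfy
        have h1 := Hb P rfl rfl le_rfl msq hmsq.le hcap M hMK (L ^ 1) rfl (underPtN L 1 n M x') (underPtN L 1 n M y')
        have hcast : (((L ^ 1 : ℕ) : ℝ)) ^ P.d * cb = (L : ℝ) ^ (d + 1) * cb := by simp [hP]
        rw [hcast, blockOf_underPtN, blockOf_underPtN] at h1
        set t : ℝ := tdistT M (blockOf (L ^ n * L ^ 1) M x') (blockOf (L ^ n * L ^ 1) M y') with ht
        have hsplit2 : Real.exp (-(δb * t)) ≤ E * Real.exp (-(δb / 2 * t)) := by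
          have h2 : Real.exp (-(δb / 2 * D)) ≤ E := hEmono hδb'
          calc Real.exp (-(δb * t)) = Real.exp (-(δb / 2 * t)) * Real.exp (-(δb / 2 * t)) := by
                rw [← Real.exp_add]; ring_nf
            _ ≤ Real.exp (-(δb / 2 * D)) * Real.exp (-(δb / 2 * t)) :=
                mul_le_mul_of_nonneg_right (Real.exp_le_exp.mpr (by
                  have hδD : δb / 2 * D ≤ δb / 2 * t := mul_le_mul_of_nonneg_left hDy (half_pos hδb).le
                  linarith)) (Real.exp_pos _).le
            _ ≤ E * Real.exp (-(δb / 2 * t)) := mul_le_mul_of_nonneg_right h2 (Real.exp_pos _).le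
        rw [abs_mul, abs_mul, abs_of_nonneg hw0]
        calc w * |constrainedProp (L ^ 1) M (aK a L 1) (((L ^ 1 : ℕ) : ℝ) ^ 2) msq (underPtN L 1 n M x') (underPtN L 1 n M y')| * |f' y'|
            ≤ w * ((L : ℝ) ^ (d + 1) * cb * Real.exp (-(δb * t))) * F :=
              mul_le_mul (mul_le_mul_of_nonneg_left h1 hw0) (hF y') (abs_nonneg _) (by positivity)
          _ ≤ w * ((L : ℝ) ^ (d + 1) * cb * (E * Real.exp (-(δb / 2 * t)))) * F :=
              mul_le_mul_of_nonneg_right (mul_le_mul_of_nonneg_left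
                (mul_le_mul_of_nonneg_left hsplit2 (by positivity)) hw0) hF0
          _ = _ := by ring
      have hrow := rowSum_exp_blocks_le (L ^ n * L ^ 1) M (half_pos hδb) (blockOf (L ^ n * L ^ 1) M x')
      calc |∑ y', w * constrainedProp (L ^ 1) M (aK a L 1) (((L ^ 1 : ℕ) : ℝ) ^ 2) msq (underPtN L 1 n M x')
              (underPtN L 1 n M y') * f' y'|
          ≤ ∑ y', |w * constrainedProp (L ^ 1) M (aK a L 1) (((L ^ 1 : ℕ) : ℝ) ^ 2) msq (underPtN L 1 n M x')
              (underPtN L 1 n M y') * f' y'| := Finset.abs_sum_le_sum_abs _ _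
        _ ≤ ∑ y', w * ((L : ℝ) ^ (d + 1) * cb * E * F)
              * Real.exp (-(δb / 2 * tdistT M (blockOf (L ^ n * L ^ 1) M x') (blockOf (L ^ n * L ^ 1) M y'))) :=
            Finset.sum_le_sum fun y' _ => hb y'
        _ = w * ((L : ℝ) ^ (d + 1) * cb * E * F)
              * ∑ y', Real.exp (-(δb / 2 * tdistT M (blockOf (L ^ n * L ^ 1) M x') (blockOf (L ^ n * L ^ 1) M y'))) := by
            rw [Finset.mul_sum]
        _ ≤ w * ((L : ℝ) ^ (d + 1) * cb * E * F) * ((((L ^ n * L ^ 1 : ℕ) : ℝ)) ^ (d + 1) * latticeConst (d + 1) (δb / 2)) :=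
            mul_le_mul_of_nonneg_left (by exact_mod_cast hrow) (by positivity)
        _ = (L : ℝ) ^ (d + 1) * cb * latticeConst (d + 1) (δb / 2) * E * F := by
            have hN0 : ((((L ^ n * L ^ 1 : ℕ) : ℝ)) ^ (d + 1)) ≠ 0 :=
              pow_ne_zero _ (by exact_mod_cast NeZero.ne (L ^ n * L ^ 1))
            rw [hw]; field_simp
    have hθ1 : B₁ ≤ C * θ ^ 1 := by
      rw [pow_one]
      calc B₁ = (L : ℝ) * B₁ * (L : ℝ)⁻¹ := by field_simp
        _ ≤ C * θ := mul_le_mul hCB hθL (inv_pos.mpr hL0).le hC.le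
    calc |∑ y', w * (constrainedProp (L ^ n * L ^ 1) M (aK a L (1 + n)) (((L ^ n * L ^ 1 : ℕ) : ℝ) ^ 2) msq x' y'
            - constrainedProp (L ^ 1) M (aK a L 1) (((L ^ 1 : ℕ) : ℝ) ^ 2) msq (underPtN L 1 n M x') (underPtN L 1 n M y'))
            * f' y'|
        = |∑ y', (fineOp (L ^ n * L ^ 1) M (aK a L (1 + n)) (((L ^ n * L ^ 1 : ℕ) : ℝ) ^ 2) msq)⁻¹ x' y' * f' y'
            - ∑ y', w * constrainedProp (L ^ 1) M (aK a L 1) (((L ^ 1 : ℕ) : ℝ) ^ 2) msq (underPtN L 1 n M x')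
              (underPtN L 1 n M y') * f' y'| := by rw [hsum_eq]
      _ ≤ |∑ y', (fineOp (L ^ n * L ^ 1) M (aK a L (1 + n)) (((L ^ n * L ^ 1 : ℕ) : ℝ) ^ 2) msq)⁻¹ x' y' * f' y'|
            + |∑ y', w * constrainedProp (L ^ 1) M (aK a L 1) (((L ^ 1 : ℕ) : ℝ) ^ 2) msq (underPtN L 1 n M x')
              (underPtN L 1 n M y') * f' y'| := abs_sub _ _
      _ ≤ c₀ * E * F + (L : ℝ) ^ (d + 1) * cb * latticeConst (d + 1) (δb / 2) * E * F := add_le_add hfine hcoarse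
      _ = B₁ * (E * F) := by rw [hB₁]; ring
      _ ≤ C * θ ^ 1 * (E * F) := mul_le_mul_of_nonneg_right hθ1 (by positivity)
      _ = C * θ ^ 1 * E * F := by ring
  | succ K hK IH =>
    intro n hn e M _ hM msq hmsq hcap f'' F hF D x'' hsupp0
    have hF0 : 0 ≤ F := (abs_nonneg _).trans (hF x'')
    obtain rfl : M = fun _ => 2 * L ^ e := funext hM
    set i : KSliceIdx d := ⟨e, K, hK, n, hn, 0, Nat.zero_le e, 1, le_rfl⟩ with hidef
    have h : ∀ ν, fine (L ^ n * L ^ K * L) (ksM L i) ν = fine (L ^ n * L ^ (K + 1)) (ksM L i) ν :=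
      fine_assoc L K n (ksM L i)
    obtain ⟨x', rfl⟩ := ((flatten (L ^ n * L ^ K) L (ksM L i)).trans (torCongr h)).surjective x''
    simp only [Equiv.trans_apply] at hsupp0 ⊢
    set E : ℝ := Real.exp (-(δ * D)) with hEdef
    have hE0 : 0 < E := Real.exp_pos _
    have hgF : ∀ y' : Tor (fine (L ^ n * L ^ K) (ksU L i)),
        |(fun y' => f'' (torCongr h (flatten (L ^ n * L ^ K) L (ksM L i) y'))) y'| ≤ F := fun y' => hF _
    have hL2 : (0 : ℝ) < (L : ℝ) ^ 2 := by positivity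
    have hm2 : 0 < msq / (L : ℝ) ^ 2 := div_pos hmsq hL2
    have hm2cap : msq / (L : ℝ) ^ 2 ≤ m0sq := by
      have h1 : (1 : ℝ) ≤ (L : ℝ) ^ 2 := one_le_pow₀ hL1'
      exact (div_le_self hmsq.le h1).trans hcap
    have hM' : ∀ μ, ksU L i μ = 2 * L ^ (e + 1) := fun μ => by
      show L * (2 * L ^ e) = 2 * L ^ (e + 1)
      ring
    -- the support condition one level down: block distances only grow under the peel
    have hsupp : ∀ y' : Tor (fine (L ^ n * L ^ K) (ksU L i)),
        (fun y' => f'' (torCongr h (flatten (L ^ n * L ^ K) L (ksM L i) y'))) y' ≠ 0 →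
          (D : ℝ) ≤ tdistT (ksU L i) (blockOf (L ^ K) (ksU L i) (underPtN L K n (ksU L i) x'))
            (blockOf (L ^ K) (ksU L i) (underPtN L K n (ksU L i) y')) := by
      intro y' hy
      have h0 := hsupp0 (torCongr h (flatten (L ^ n * L ^ K) L (ksM L i) y')) hy
      rw [underPtN_flatten L K n (ksM L i) h x', underPtN_flatten L K n (ksM L i) h y'] at h0
      set ux := underPtN L K n (ksU L i) x' with hux
      set uy := underPtN L K n (ksU L i) y' with huy
      have hBx : blockOf (L ^ (K + 1)) (fun _ : Fin (d + 1) => 2 * L ^ e) (flatten (L ^ K) L (ksM L i) ux)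
          = blockOf L (ksM L i) (blockOf (L ^ K) (ksU L i) ux) := blockOf_flatten (L ^ K) L (ksM L i) ux
      have hBy : blockOf (L ^ (K + 1)) (fun _ : Fin (d + 1) => 2 * L ^ e) (flatten (L ^ K) L (ksM L i) uy)
          = blockOf L (ksM L i) (blockOf (L ^ K) (ksU L i) uy) := blockOf_flatten (L ^ K) L (ksM L i) uy
      rw [hBx, hBy] at h0
      have hgrow := mul_tdistT_blockOf_le L (ksM L i) (blockOf (L ^ K) (ksU L i) ux) (blockOf (L ^ K) (ksU L i) uy)
      have hsub0 := tdistT_nonneg (ksU L i) (blockOf (L ^ K) (ksU L i) ux) (blockOf (L ^ K) (ksU L i) uy)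
      -- `D = 0` is trivial; for `D ≥ 1`: `D_sub ≥ L·D − (L − 1) ≥ D`
      rcases Nat.eq_zero_or_pos D with hD0 | hDpos
      · rw [hD0, Nat.cast_zero]; exact hsub0
      · have hD1 : (1 : ℝ) ≤ D := by exact_mod_cast hDpos
        have hprod : 0 ≤ ((L : ℝ) - 1) * ((D : ℝ) - 1) := mul_nonneg (by linarith) (by linarith)
        nlinarith
    have hpeel := fullPropOp_peel_pair L hL ha hmsq i h f'' x'
    set w : ℝ := ((((L ^ n * L ^ K : ℕ) : ℝ)) ^ (d + 1))⁻¹ with hw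
    have hIH : |∑ y', w * (constrainedProp (L ^ n * L ^ K) (ksU L i) (aK a L (K + n)) (((L ^ n * L ^ K : ℕ) : ℝ) ^ 2)
              (msq / (L : ℝ) ^ 2) x' y'
            - constrainedProp (L ^ K) (ksU L i) (aK a L K) (((L ^ K : ℕ) : ℝ) ^ 2) (msq / (L : ℝ) ^ 2)
              (underPtN L K n (ksU L i) x') (underPtN L K n (ksU L i) y'))
            * f'' (torCongr h (flatten (L ^ n * L ^ K) L (ksM L i) y'))| ≤ C * θ ^ K * E * F :=
      IH n hn (e + 1) (ksU L i) hM' (msq / (L : ℝ) ^ 2) hm2 hm2cap _ F hgF D x' hsupp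
    have hS0 : |∑ y', w * (ksSlice' L a (msq / (L : ℝ) ^ 2) i x' y'
            - ksSlice L a (msq / (L : ℝ) ^ 2) i (underPtN L K n (ksU L i) x') (underPtN L K n (ksU L i) y'))
            * f'' (torCongr h (flatten (L ^ n * L ^ K) L (ksM L i) y'))|
          ≤ Cr * latticeConst (d + 1) (κ / 2) * θ ^ K * Real.exp (-(κ / 2 * D)) * F :=
      sliceOp_pair_decay_le L hκ hCr.le i (Hr (msq / (L : ℝ) ^ 2) hm2 hm2cap i) _ hgF x' hsupp
    have hS : |∑ y', w * (ksSlice' L a (msq / (L : ℝ) ^ 2) i x' y'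
            - ksSlice L a (msq / (L : ℝ) ^ 2) i (underPtN L K n (ksU L i) x') (underPtN L K n (ksU L i) y'))
            * f'' (torCongr h (flatten (L ^ n * L ^ K) L (ksM L i) y'))|
          ≤ Cr * latticeConst (d + 1) (κ / 2) * θ ^ K * E * F :=
      hS0.trans (mul_le_mul_of_nonneg_right (mul_le_mul_of_nonneg_left (hEmono hδκ) (by positivity)) hF0)
    have hsum : ∑ y', w * ((constrainedProp (L ^ n * L ^ K) (ksU L i) (aK a L (K + n)) (((L ^ n * L ^ K : ℕ) : ℝ) ^ 2)
              (msq / (L : ℝ) ^ 2) x' y'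
            - constrainedProp (L ^ K) (ksU L i) (aK a L K) (((L ^ K : ℕ) : ℝ) ^ 2) (msq / (L : ℝ) ^ 2)
              (underPtN L K n (ksU L i) x') (underPtN L K n (ksU L i) y'))
            + (ksSlice' L a (msq / (L : ℝ) ^ 2) i x' y'
              - ksSlice L a (msq / (L : ℝ) ^ 2) i (underPtN L K n (ksU L i) x') (underPtN L K n (ksU L i) y')))
            * f'' (torCongr h (flatten (L ^ n * L ^ K) L (ksM L i) y'))
        = ∑ y', w * (constrainedProp (L ^ n * L ^ K) (ksU L i) (aK a L (K + n)) (((L ^ n * L ^ K : ℕ) : ℝ) ^ 2)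
              (msq / (L : ℝ) ^ 2) x' y'
            - constrainedProp (L ^ K) (ksU L i) (aK a L K) (((L ^ K : ℕ) : ℝ) ^ 2) (msq / (L : ℝ) ^ 2)
              (underPtN L K n (ksU L i) x') (underPtN L K n (ksU L i) y'))
            * f'' (torCongr h (flatten (L ^ n * L ^ K) L (ksM L i) y'))
          + ∑ y', w * (ksSlice' L a (msq / (L : ℝ) ^ 2) i x' y'
            - ksSlice L a (msq / (L : ℝ) ^ 2) i (underPtN L K n (ksU L i) x') (underPtN L K n (ksU L i) y'))
            * f'' (torCongr h (flatten (L ^ n * L ^ K) L (ksM L i) y')) := by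
      rw [← Finset.sum_add_distrib]
      exact Finset.sum_congr rfl fun y' _ => by ring
    have hgain : ((L : ℝ) ^ 2)⁻¹ * (C * θ ^ K * E * F + Cr * latticeConst (d + 1) (κ / 2) * θ ^ K * E * F)
        ≤ C * θ ^ (K + 1) * E * F := by
      have h2L : (2 : ℝ) ≤ L := by exact_mod_cast hL
      have hq : 0 ≤ θ ^ K * E * F := by positivity
      have hstep1 : C * θ ^ K * E * F + Cr * latticeConst (d + 1) (κ / 2) * θ ^ K * E * F ≤ 2 * C * (θ ^ K * E * F) := by
        have h1 : C * θ ^ K * E * F + Cr * latticeConst (d + 1) (κ / 2) * θ ^ K * E * F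
            = (C + Cr * latticeConst (d + 1) (κ / 2)) * (θ ^ K * E * F) := by ring
        rw [h1]
        exact mul_le_mul_of_nonneg_right (by linarith) hq
      have hstep2 : ((L : ℝ) ^ 2)⁻¹ * (2 * C) ≤ C * θ := by
        rw [show ((L : ℝ) ^ 2)⁻¹ * (2 * C) = (2 / (L : ℝ)) * (C * (L : ℝ)⁻¹) by field_simp]
        have h2 : 2 / (L : ℝ) ≤ 1 := (div_le_one hL0).mpr h2L
        calc 2 / (L : ℝ) * (C * (L : ℝ)⁻¹) ≤ 1 * (C * (L : ℝ)⁻¹) := mul_le_mul_of_nonneg_right h2 (by positivity)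
          _ = C * (L : ℝ)⁻¹ := one_mul _
          _ ≤ C * θ := mul_le_mul_of_nonneg_left hθL hC.le
      calc ((L : ℝ) ^ 2)⁻¹ * (C * θ ^ K * E * F + Cr * latticeConst (d + 1) (κ / 2) * θ ^ K * E * F)
          ≤ ((L : ℝ) ^ 2)⁻¹ * (2 * C * (θ ^ K * E * F)) := mul_le_mul_of_nonneg_left hstep1 (by positivity)
        _ = ((L : ℝ) ^ 2)⁻¹ * (2 * C) * (θ ^ K * E * F) := by ring
        _ ≤ C * θ * (θ ^ K * E * F) := mul_le_mul_of_nonneg_right hstep2 hq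
        _ = C * θ ^ (K + 1) * E * F := by rw [pow_succ]; ring
    have hL2i : (0 : ℝ) ≤ ((L : ℝ) ^ 2)⁻¹ := by positivity
    calc |∑ y'' : Tor (fine (L ^ n * L ^ (K + 1)) (ksM L i)),
            ((((L ^ n * L ^ (K + 1) : ℕ) : ℝ) ^ (d + 1))⁻¹ *
              (constrainedProp (L ^ n * L ^ (K + 1)) (ksM L i) (aK a L (K + 1 + n))
                  (((L ^ n * L ^ (K + 1) : ℕ) : ℝ) ^ 2) msq
                  (torCongr h (flatten (L ^ n * L ^ K) L (ksM L i) x')) y''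
                - constrainedProp (L ^ K * L) (ksM L i) (aK a L (K + 1)) (((L ^ K * L : ℕ) : ℝ) ^ 2) msq
                  (underPtN L (K + 1) n (ksM L i) (torCongr h (flatten (L ^ n * L ^ K) L (ksM L i) x')))
                  (underPtN L (K + 1) n (ksM L i) y''))
              * f'' y'')|
        = ((L : ℝ) ^ 2)⁻¹ *
          |∑ y', w * (constrainedProp (L ^ n * L ^ K) (ksU L i) (aK a L (K + n)) (((L ^ n * L ^ K : ℕ) : ℝ) ^ 2)
              (msq / (L : ℝ) ^ 2) x' y'
            - constrainedProp (L ^ K) (ksU L i) (aK a L K) (((L ^ K : ℕ) : ℝ) ^ 2) (msq / (L : ℝ) ^ 2)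
              (underPtN L K n (ksU L i) x') (underPtN L K n (ksU L i) y'))
            * f'' (torCongr h (flatten (L ^ n * L ^ K) L (ksM L i) y'))
          + ∑ y', w * (ksSlice' L a (msq / (L : ℝ) ^ 2) i x' y'
            - ksSlice L a (msq / (L : ℝ) ^ 2) i (underPtN L K n (ksU L i) x') (underPtN L K n (ksU L i) y'))
            * f'' (torCongr h (flatten (L ^ n * L ^ K) L (ksM L i) y'))| := by
          rw [hpeel, hsum, abs_mul, abs_of_nonneg hL2i]
      _ ≤ ((L : ℝ) ^ 2)⁻¹ * (C * θ ^ K * E * F + Cr * latticeConst (d + 1) (κ / 2) * θ ^ K * E * F) :=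
          mul_le_mul_of_nonneg_left ((abs_add_le _ _).trans (add_le_add hIH hS)) hL2i
      _ ≤ C * θ ^ (K + 1) * E * F := hgain

end Summit.QuantumFields.YangMills.BalabanUVNodes.N15KingModelRung.Curved
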